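import Summits.QuantumFields.YangMills.Theorems.RationalShortRootRigidityNullConeDivisibility
import HarnessLib

/-!
# `RationalShortRootRigidity` — Step 4 helper (m16): higher null-cone divisibility

Helper lemma INSIDE the paper proof of crux `stmt-QuantumFields-23124` (`F4SubCurvatureDoor.RationalShortRootRigidity`,
LINE g15-A of planner ym-idea-3; Step 4 = `stub_alternation`, Chevalley-free plan HOME l15/STUB-PLAN-Alternation.md; free-hands
menu V, item (m16), statement typed in HOME l15/Helpers23124d.lean as `Helpers.NullConeDivisibilityPow` — proved here DEF-FREE with
that body verbatim):

**Lemma** (`nullConeDivisibilityPow`).  If the first `ν` derivatives `∂₀ʳ Ỹ` (`r < ν`) of `Ỹ(u,q)` vanish on the null locus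
`u = −|q|²`, then `(u + |q|²)^ν ∣ Ỹ`.

Proof: induction on `ν`, iterating the tree lemma `nullConeDivisibility` (p662563): `Ỹ = L·Ỹ₁` with `L = u + |q|²`, and the Leibniz
rule for iterated `∂₀` against the linear-in-`u` factor `L` (`∂₀L = 1`): `∂₀^{r+1}(L·Z) = L·∂₀^{r+1}Z + (r+1)·∂₀^{r}Z`
(`iterate_pderiv_nullCone_mul`), so on the null locus the hypotheses for `Ỹ` pass to `Ỹ₁` with `ν − 1`.

Mathlib + the tree lemma; THEOREMS ONLY (no definitions); no named facts; no `sorry`; default heartbeats.  Nothing about the crux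
23124, the route's rung or the Yang–Mills mass gap is proved here.  Free-hands seat `ym-line-frs-p2` g10, `--supports
stmt-QuantumFields-23124`.
-/

set_option autoImplicit false

namespace Summit.QuantumFields.YangMills.Theorems.RationalShortRootRigidity

open scoped BigOperators

/-- `∂₀ (u + |q|²) = 1`. [folklore] -/
theorem pderiv_nullCone :
    MvPolynomial.pderiv 0 (MvPolynomial.X 0 + ∑ i : Fin 3, MvPolynomial.X (Fin.succ i) ^ 2 : MvPolynomial (Fin 4) ℝ) = 1 := by
  rw [map_add, MvPolynomial.pderiv_X_self, map_sum, add_eq_left]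
  refine Finset.sum_eq_zero fun i _ => ?_
  rw [sq, Derivation.leibniz, MvPolynomial.pderiv_X_of_ne (Fin.succ_ne_zero i), smul_zero, add_zero]

/-- Leibniz rule for iterated `∂₀` against the null-cone form: `∂₀^{r+1}(L·Z) = L·∂₀^{r+1}Z + (r+1)·∂₀^{r}Z`. [folklore] -/
theorem iterate_pderiv_nullCone_mul (Z : MvPolynomial (Fin 4) ℝ) (r : ℕ) :
    (MvPolynomial.pderiv 0)^[r + 1]
        ((MvPolynomial.X 0 + ∑ i : Fin 3, MvPolynomial.X (Fin.succ i) ^ 2) * Z) =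
      (MvPolynomial.X 0 + ∑ i : Fin 3, MvPolynomial.X (Fin.succ i) ^ 2) * (MvPolynomial.pderiv 0)^[r + 1] Z +
        (r + 1) • (MvPolynomial.pderiv 0)^[r] Z := by
  induction r with
  | zero =>
    simp only [Function.iterate_one, Function.iterate_zero_apply, zero_add, one_smul]
    rw [Derivation.leibniz, pderiv_nullCone, smul_eq_mul, smul_eq_mul, mul_one]
  | succ r ih =>
    rw [Function.iterate_succ_apply', ih, map_add, map_nsmul, Derivation.leibniz, pderiv_nullCone, smul_eq_mul,
      smul_eq_mul, mul_one, ← Function.iterate_succ_apply' (MvPolynomial.pderiv 0) (r + 1),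
      ← Function.iterate_succ_apply' (MvPolynomial.pderiv 0) r]
    simp only [Nat.succ_eq_add_one]
    ring

/-- **Higher null-cone divisibility** (m16; Step 4 of the paper proof of 23124).  The statement is the body of
`Helpers.NullConeDivisibilityPow` (HOME l15/Helpers23124d.lean) verbatim. [folklore] -/
theorem nullConeDivisibilityPow :
    ∀ (ν : ℕ) (Y : MvPolynomial (Fin 4) ℝ),
      (∀ r : ℕ, r < ν → ∀ q : Fin 3 → ℝ,
        MvPolynomial.eval (Fin.cons (-(∑ i, q i ^ 2)) q) ((MvPolynomial.pderiv 0)^[r] Y) = 0) →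
      (MvPolynomial.X 0 + ∑ i : Fin 3, MvPolynomial.X (Fin.succ i) ^ 2) ^ ν ∣ Y := by
  intro ν
  induction ν with
  | zero => intro Y _; rw [pow_zero]; exact one_dvd Y
  | succ ν IH =>
    intro Y h
    have h0 : ∀ q : Fin 3 → ℝ, MvPolynomial.eval (Fin.cons (-(∑ i, q i ^ 2)) q) Y = 0 :=
      fun q => by simpa only [Function.iterate_zero_apply] using h 0 (Nat.succ_pos ν) q
    obtain ⟨Y₁, hY₁⟩ := nullConeDivisibility Y h0
    have hL : ∀ q : Fin 3 → ℝ, MvPolynomial.eval (Fin.cons (-(∑ i, q i ^ 2)) q)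
        (MvPolynomial.X 0 + ∑ i : Fin 3, MvPolynomial.X (Fin.succ i) ^ 2 : MvPolynomial (Fin 4) ℝ) = 0 := by
      intro q
      simp only [map_add, map_sum, map_pow, MvPolynomial.eval_X, Fin.cons_zero, Fin.cons_succ, neg_add_cancel]
    have h1 : ∀ r : ℕ, r < ν → ∀ q : Fin 3 → ℝ,
        MvPolynomial.eval (Fin.cons (-(∑ i, q i ^ 2)) q) ((MvPolynomial.pderiv 0)^[r] Y₁) = 0 := by
      intro r hr q
      have h2 := h (r + 1) (by omega) q
      rw [hY₁, iterate_pderiv_nullCone_mul, map_add, map_mul, hL q, zero_mul, zero_add, map_nsmul, nsmul_eq_mul] at h2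
      exact (mul_eq_zero.1 h2).resolve_left (by positivity)
    obtain ⟨Y₂, hY₂⟩ := IH Y₁ h1
    exact ⟨Y₂, by rw [hY₁, hY₂, pow_succ']; ring⟩

end Summit.QuantumFields.YangMills.Theorems.RationalShortRootRigidity
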